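import Literature.MathematicalPhysics.QuantumManyBody.GroundState
import Literature.MathematicalPhysics.QuantumManyBody.BoseGasHardSet
import Summits.AtomisticToContinuum.BoseEinsteinCondensation.Theorems.BECCutLineWeakDisorderGroundStateRigidityStubRigidityOfUnique
import HarnessLib

/-!
# Crux `GroundStateRigidity` (stmt-AtomisticToContinuum-9072), line `Sketch`:
# the registered stub `stub_vanishOffFree`

Supports (does not close) stmt-AtomisticToContinuum-9072; stub `stub_vanishOffFree` of line
Sketch. **Closed-form ground states of a hard-core gas live on the free region.** For a pair
profile `v` with `v = ⊤` on `[0, b]`, `b > 0`, every ground state `Ψ` (`IsGroundState v L Ψ`)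
vanishes almost everywhere off the free region
`{X ∈ Λ_L^N | |xᵢ - xⱼ| > b for all i ≠ j}`.

## Proof

Off the box `Ψ = 0` pointwise (`IsGroundState.eq_zero`). On the contact set
`K = {X | ∃ i ≠ j, |xᵢ - xⱼ| ≤ b}` (measurable: a finite union of closed sets) the interaction is
`⊤` (`apply_dist_le_interaction`). Since `q̄[Ψ] < ⊤` there is an approximating sequence of trial
states `Φₙ → Ψ` in `L²` with `liminf` energy `< ⊤`, hence a subsequence of finite energies
(`frequently_lt_of_liminf_lt`, `extraction_of_frequently_atTop`); a finite-energy trial state has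
`⊤ · ∫_K |Φₙ|² = ∫_K (interaction) |Φₙ|² ≤ energy < ⊤`, so `∫_K |Φₙ|² = 0`. Then
`∫_K |Ψ|² ≤ 2 ∫ |Φₙ - Ψ|² + 2 ∫_K |Φₙ|² = 2 ∫ |Φₙ - Ψ|² → 0`, so `Ψ = 0` a.e. on `K`
(all of this for any measurable `K` on which the interaction is `⊤`).
Finally `X ∉ {Z ∈ Λ_L^N | ∀ i ≠ j, b < |zᵢ - zⱼ|}` means `X ∉ Λ_L^N` or `X ∈ K`.
-/

noncomputable section

open MeasureTheory Filter Set Metric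
open scoped ENNReal NNReal Topology

namespace Summit.AtomisticToContinuum.BoseEinsteinCondensation.Theorems.GroundStateRigidity

open Literature.MathematicalPhysics.QuantumManyBody.BoseGas

namespace VanishOffFree

variable {N : ℕ} {v : ℝ → ℝ≥0∞} {L b : ℝ}

/-- The contact set `K_b = {X | ∃ i ≠ j, |xᵢ - xⱼ| ≤ b}` (configurations with two particles at
mutual distance `≤ b`) is measurable: a finite union of closed sets. [folklore] -/
theorem measurableSet_contactSet (N : ℕ) (b : ℝ) :
    MeasurableSet {X : Config N | ∃ i j : Fin N, i ≠ j ∧ dist (X i) (X j) ≤ b} := by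
  have h : {X : Config N | ∃ i j : Fin N, i ≠ j ∧ dist (X i) (X j) ≤ b} =
      ⋃ i : Fin N, ⋃ j : Fin N, {X : Config N | i ≠ j ∧ dist (X i) (X j) ≤ b} := by
    ext X
    simp only [mem_setOf_eq, mem_iUnion]
  rw [h]
  refine MeasurableSet.iUnion fun i => MeasurableSet.iUnion fun j => ?_
  rw [setOf_and]
  refine (MeasurableSet.const (i ≠ j)).inter ?_
  exact (isClosed_le ((continuous_apply i).dist (continuous_apply j))
    continuous_const).measurableSet

/-- A hard-core interaction (`v = ⊤` on `[0, b]`) is `+∞` at a configuration with two particles at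
mutual distance `≤ b`. [folklore] -/
theorem interaction_eq_top (hv : ∀ s : ℝ, s ∈ Set.Icc 0 b → v s = ⊤) {X : Config N}
    {i j : Fin N} (hij : i ≠ j) (hd : dist (X i) (X j) ≤ b) : interaction v X = ⊤ :=
  eq_top_iff.2 ((hv _ ⟨dist_nonneg, hd⟩).symm.le.trans (apply_dist_le_interaction v X hij))

/-- A finite-energy trial state vanishes a.e. on a measurable set `K` where the interaction is
`+∞`: `∫_K |Φ|² = 0` (as `⊤ · ∫_K |Φ|² ≤ energy < ⊤`). [folklore] -/
theorem setLIntegral_trialState_eq_zero {K : Set (Config N)} (hK : MeasurableSet K)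
    (hKv : ∀ X ∈ K, interaction v X = ⊤) (Φ : TrialState N L) (hE : energy v Φ < ⊤) :
    ∫⁻ X in K, (‖Φ.ψ X‖₊ : ℝ≥0∞) ^ 2 = 0 := by
  have hm : Measurable fun X => (‖Φ.ψ X‖₊ : ℝ≥0∞) ^ 2 :=
    (Φ.contDiff.continuous.measurable.nnnorm.coe_nnreal_ennreal).pow_const 2
  by_contra h0
  have h1 : ∫⁻ X in K, interaction v X * (‖Φ.ψ X‖₊ : ℝ≥0∞) ^ 2 ≤ energy v Φ :=
    (setLIntegral_le_lintegral _ _).trans (lintegral_mono fun X => le_add_self)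
  have h2 : ∫⁻ X in K, interaction v X * (‖Φ.ψ X‖₊ : ℝ≥0∞) ^ 2 =
      ⊤ * ∫⁻ X in K, (‖Φ.ψ X‖₊ : ℝ≥0∞) ^ 2 := by
    rw [← lintegral_const_mul ⊤ hm]
    exact setLIntegral_congr_fun hK fun X hX => by rw [hKv X hX]
  rw [h2, ENNReal.top_mul h0] at h1
  exact lt_irrefl _ (h1.trans_lt hE)

/-- `L²` bookkeeping: `∫_K |Ψ|² ≤ 2 ∫ |Φ - Ψ|² + 2 ∫_K |Φ|²`
(`|Ψ|² ≤ 2|Ψ - Φ|² + 2|Φ|²` pointwise). [folklore] -/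
theorem setLIntegral_le_of_trialState {Ψ : Config N → ℂ} (hΨ : Measurable Ψ)
    (Φ : TrialState N L) (K : Set (Config N)) :
    ∫⁻ X in K, (‖Ψ X‖₊ : ℝ≥0∞) ^ 2 ≤
      2 * (∫⁻ X, (‖Φ.ψ X - Ψ X‖₊ : ℝ≥0∞) ^ 2) + 2 * ∫⁻ X in K, (‖Φ.ψ X‖₊ : ℝ≥0∞) ^ 2 := by
  have hmA : Measurable fun X => (‖Φ.ψ X - Ψ X‖₊ : ℝ≥0∞) ^ 2 :=
    ((Φ.contDiff.continuous.measurable.sub hΨ).nnnorm.coe_nnreal_ennreal).pow_const 2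
  have hmB : Measurable fun X => (‖Φ.ψ X‖₊ : ℝ≥0∞) ^ 2 :=
    (Φ.contDiff.continuous.measurable.nnnorm.coe_nnreal_ennreal).pow_const 2
  calc ∫⁻ X in K, (‖Ψ X‖₊ : ℝ≥0∞) ^ 2
      ≤ ∫⁻ X in K, 2 * (‖Φ.ψ X - Ψ X‖₊ : ℝ≥0∞) ^ 2 + 2 * (‖Φ.ψ X‖₊ : ℝ≥0∞) ^ 2 := by
        refine lintegral_mono fun X => ?_
        have e : Ψ X - Φ.ψ X + Φ.ψ X = Ψ X := sub_add_cancel _ _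
        calc (‖Ψ X‖₊ : ℝ≥0∞) ^ 2 = (‖Ψ X - Φ.ψ X + Φ.ψ X‖₊ : ℝ≥0∞) ^ 2 := by rw [e]
          _ ≤ 2 * (‖Ψ X - Φ.ψ X‖₊ : ℝ≥0∞) ^ 2 + 2 * (‖Φ.ψ X‖₊ : ℝ≥0∞) ^ 2 :=
              coe_nnnorm_add_sq_le _ _
          _ = 2 * (‖Φ.ψ X - Ψ X‖₊ : ℝ≥0∞) ^ 2 + 2 * (‖Φ.ψ X‖₊ : ℝ≥0∞) ^ 2 := by
              rw [← neg_sub (Φ.ψ X) (Ψ X), nnnorm_neg]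
    _ = 2 * (∫⁻ X in K, (‖Φ.ψ X - Ψ X‖₊ : ℝ≥0∞) ^ 2) +
          2 * ∫⁻ X in K, (‖Φ.ψ X‖₊ : ℝ≥0∞) ^ 2 := by
        rw [lintegral_add_left (hmA.const_mul 2), lintegral_const_mul 2 hmA,
          lintegral_const_mul 2 hmB]
    _ ≤ 2 * (∫⁻ X, (‖Φ.ψ X - Ψ X‖₊ : ℝ≥0∞) ^ 2) + 2 * ∫⁻ X in K, (‖Φ.ψ X‖₊ : ℝ≥0∞) ^ 2 :=
        add_le_add_left (mul_le_mul_right (setLIntegral_le_lintegral _ _) _) _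

/-- **A ground state vanishes in `L²` on a measurable set `K` where the interaction is `+∞`**:
`∫_K |Ψ|² = 0`. Along a subsequence of finite energies of an approximating sequence `Φₙ → Ψ`
(which exists as `q̄[Ψ] < ⊤`), `∫_K |Ψ|² ≤ 2 ∫ |Φₙ - Ψ|² + 2 ∫_K |Φₙ|² = 2 ∫ |Φₙ - Ψ|² → 0`.
[folklore] -/
theorem setLIntegral_groundState_eq_zero {K : Set (Config N)} (hK : MeasurableSet K)
    (hKv : ∀ X ∈ K, interaction v X = ⊤) {Ψ : Config N → ℂ} (hΨ : IsGroundState v L Ψ) :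
    ∫⁻ X in K, (‖Ψ X‖₊ : ℝ≥0∞) ^ 2 = 0 := by
  -- an approximating sequence with finite `liminf` energy, and a finite-energy subsequence
  obtain ⟨Φ, hΦ⟩ := iInf_lt_iff.1 (lt_top_iff_ne_top.2 hΨ.closedEnergy_ne_top)
  obtain ⟨hΦΨ, hlim⟩ := iInf_lt_iff.1 hΦ
  have hfreq : ∃ᶠ n in atTop, energy v (Φ n) < ⊤ := frequently_lt_of_liminf_lt (h := hlim)
  obtain ⟨φ, hφ, hφE⟩ := extraction_of_frequently_atTop hfreq
  have hle : ∀ n, ∫⁻ X in K, (‖Ψ X‖₊ : ℝ≥0∞) ^ 2 ≤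
      2 * ∫⁻ X, (‖(Φ (φ n)).ψ X - Ψ X‖₊ : ℝ≥0∞) ^ 2 := fun n => by
    have h := setLIntegral_le_of_trialState hΨ.measurable (Φ (φ n)) K
    rw [setLIntegral_trialState_eq_zero hK hKv (Φ (φ n)) (hφE n)] at h
    simpa using h
  have ht : Tendsto (fun n => 2 * ∫⁻ X, (‖(Φ (φ n)).ψ X - Ψ X‖₊ : ℝ≥0∞) ^ 2) atTop
      (𝓝 (2 * 0)) :=
    ENNReal.Tendsto.const_mul (hΦΨ.comp hφ.tendsto_atTop) (Or.inr ENNReal.ofNat_ne_top)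
  rw [mul_zero] at ht
  exact le_antisymm (ge_of_tendsto' ht hle) zero_le

/-- **A ground state vanishes a.e. on a measurable set where the interaction is `+∞`.**
[folklore] -/
theorem ae_eq_zero_of_interaction_eq_top {K : Set (Config N)} (hK : MeasurableSet K)
    (hKv : ∀ X ∈ K, interaction v X = ⊤) {Ψ : Config N → ℂ} (hΨ : IsGroundState v L Ψ) :
    ∀ᵐ X : Config N, X ∈ K → Ψ X = 0 := by
  have hm : Measurable fun X => (‖Ψ X‖₊ : ℝ≥0∞) ^ 2 :=
    (hΨ.measurable.nnnorm.coe_nnreal_ennreal).pow_const 2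
  have h := (lintegral_eq_zero_iff hm).1 (setLIntegral_groundState_eq_zero hK hKv hΨ)
  rw [Filter.EventuallyEq, ae_restrict_iff' hK] at h
  filter_upwards [h] with X hX hXK
  have h0 : (‖Ψ X‖₊ : ℝ≥0∞) = 0 := by simpa using hX hXK
  simpa using h0

end VanishOffFree

/-! ### The stub -/

open VanishOffFree in
/-- **Stub `stub_vanishOffFree` of line `Sketch` — closed-form ground states of a hard-core gas
live on the free region.** For a pair profile `v` with `v = ⊤` on `[0, b]` (`b > 0`), every
ground state `Ψ` vanishes a.e. off `{X ∈ Λ_L^N | ∀ i ≠ j, b < |xᵢ - xⱼ|}`: off the box by the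
Dirichlet condition, and on the contact set `{∃ i ≠ j, |xᵢ - xⱼ| ≤ b}` because there the
interaction is `+∞`, so the finite-energy trial states approximating `Ψ` in `L²` vanish on it
(`VanishOffFree.ae_eq_zero_of_interaction_eq_top`). [folklore] -/
theorem stub_vanishOffFree :
    ∀ (N : ℕ) (v : ℝ → ℝ≥0∞) (L b : ℝ), 0 < b → (∀ s : ℝ, s ∈ Set.Icc 0 b → v s = ⊤) →
      ∀ Ψ : Config N → ℂ, IsGroundState v L Ψ →
        ∀ᵐ X : Config N,
          X ∉ {Z : Config N | Z ∈ boxN N L ∧ ∀ i j : Fin N, i ≠ j → b < dist (Z i) (Z j)} →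
            Ψ X = 0 := by
  intro N v L b _ hv Ψ hΨ
  have hKv : ∀ X ∈ {X : Config N | ∃ i j : Fin N, i ≠ j ∧ dist (X i) (X j) ≤ b},
      interaction v X = ⊤ := fun X ⟨_, _, hij, hd⟩ => interaction_eq_top hv hij hd
  filter_upwards [ae_eq_zero_of_interaction_eq_top (measurableSet_contactSet N b) hKv hΨ]
    with X hXK hXS
  by_cases hbox : X ∈ boxN N L
  · refine hXK ?_
    by_contra hK
    refine hXS ⟨hbox, fun i j hij => ?_⟩
    by_contra hlt
    exact hK ⟨i, j, hij, not_lt.1 hlt⟩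
  · exact hΨ.eq_zero X hbox

end Summit.AtomisticToContinuum.BoseEinsteinCondensation.Theorems.GroundStateRigidity

end
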